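import Summits.BirchSwinnertonDyer.BirchSwinnertonDyer.Theorems.BiquadraticEisensteinDescentHeegnerTwistCouplingInSupplySymbolicMonskyEvenKernelParity
import HarnessLib

set_option linter.dupNamespace false -- `Summit.BirchSwinnertonDyer.BirchSwinnertonDyer.Theorems.…` (summit = sub)
set_option autoImplicit false

/-!
# Crux `HeegnerTwistCouplingInSupply` (stmt-BirchSwinnertonDyer-21381) — EVEN UNIVERSALITY ON THE FAMILY `P_b ≡ 1, 3 (mod 8)`: an order-three
# symmetry of the even virtual kernel makes the design `δ = 1` good for EVERY base — NO exceptional class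

Route `BiquadraticEisensteinDescent` (cell `pub/bsd-wall`, width seat `bsd-wall-cm-bed-w3` g24; `--supports` 21381, helper). Companion of
`…SymbolicMonskyEvenDesignNegTwoTrivial` (family `(2/P_b) = +1`). Here: every odd base prime has `[(2/P_b) = −1] = [P_b ≡ 3 (4)]`, i.e.
`P_b ≡ 1` or `3 (mod 8)` (`d = m`), with an odd number `≡ 3 (mod 8)` (root number `−1` for `n = 2·P₀⋯P_k`).
MECHANISM. With `d = m` the alternating matrix `Ŝ + δδᵀ` of `…EvenKernelParity` (whose kernel is `𝒦_ev ⊕ ⟨(0,1)⟩` in the coordinates `(u; u+v)`)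
equals `[[L+Lᵀ, Lᵀ],[L, L+Lᵀ]] = N + Nᵀ` with `N = L ⊗ (1 0; 1 1)` (quadratic reciprocity `Lᵀ = L + mmᵀ + D_m`), and the order-three map
`(u; w) ↦ (w; u + w)` preserves it — it cycles the three coordinate subspaces `{w = 0} → {u = 0} → {u = w}`. Concretely:
* ★ `sum_negNegOne_mul_snd_eq_zero_of_negTwo_eq` — `⟨m, v⟩ = 0` on `𝒦_ev`; ★ `one_zero_mem_evenVirtualKernel_of_negTwo_eq` — `(1, 0) ∈ 𝒦_ev`;
* ★★ `cycle_mem_evenVirtualKernel_of_negTwo_eq` — `(u, v) ∈ 𝒦_ev ⇒ (u + v, u + ⟨m,u⟩·1) ∈ 𝒦_ev`;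
* ★★ `theta_mem_evenPencil_one_of_negTwo_eq` — the even pencil `W_ev(1)` is invariant under `θ(p, q) = (q, p + q)`, which cycles
  `V×0 → 0×V → Δ → V×0`; so the three plane sections of `W_ev(1)` have ONE common dimension `e`, and `2e ≤ dim W_ev(1) = dim 𝒦_ev + 1`;
* ★★★ `exists_patternFree_even_design_of_negTwo_eq_negNegOne` — hence `δ = 1` satisfies EVEN THEOREM A (`exists_patternFree_even_design_pencil_of_odd`,
  p751399): a pattern-free Heegner recipe with `τ₀^{ev} + 1 = (dim 𝒦_ev + 1)/2 + 1` auxiliary primes on EVERY base of the family, every `k`.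
Numerics (memo EVEN-EXCEPTIONAL-CLASS-w3g24 §2c): 191 736 sampled bases of the family (`K ≤ 10`): no exceptional base, δ = 1 (indeed every natural δ)
good; the three sections equal in 110 232/110 232.

HONEST FRAMING: RUNG-LEVEL corner layer (even congruent `j = 1728` families `E_{2n₀}`); an existence theorem about Monsky matrices — instances of the crux
still need located primes and the print input (Burungale–Tian); the crux as stated (C⁺), its registered stubs and BSD are NOT touched; nothing is
closed. THEOREMS ONLY (no `def`, no instance, no notation).
Reference: [HeathBrown1994] D. R. Heath-Brown, Invent. Math. 118 (1994) 331–370, appendix (Monsky), typescript p. 41 L20–L36.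
-/

namespace Summit.BirchSwinnertonDyer.BirchSwinnertonDyer.Theorems.SymbolicMonsky

section ClassesOneThree

open Module Matrix

variable {k : ℕ} (base : SymbData (k + 1))

/-- Column sums of the Laplacian: `Σ_i Σ_j [(P_j/P_i) = −1](y_j + y_i) = (1 + μ)⟨m,y⟩` (quadratic reciprocity `bz_neg_swap`). -/
private theorem sum_lap_eq' (y : Fin (k + 1) → ZMod 2) :
    (∑ i, ∑ j, bz (base.neg i j) * (y j + y i)) =
      (1 + ∑ b, bz (negNegOne (base.cls b))) * ∑ j, bz (negNegOne (base.cls j)) * y j := by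
  have h2 : ∀ x : ZMod 2, x + x = 0 := by decide
  have hsq : ∀ x : ZMod 2, x * x = x := by decide
  have e1 : (∑ i, ∑ j, bz (base.neg i j) * (y j + y i)) = ∑ i, ∑ j, (bz (base.neg j i) + bz (base.neg i j)) * y i := by
    have : (∑ i, ∑ j, bz (base.neg i j) * (y j + y i)) = (∑ i, ∑ j, bz (base.neg i j) * y j) + ∑ i, ∑ j, bz (base.neg i j) * y i := by
      rw [← Finset.sum_add_distrib]
      refine Finset.sum_congr rfl fun i _ => ?_
      rw [← Finset.sum_add_distrib]
      exact Finset.sum_congr rfl fun j _ => by ring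
    rw [this, Finset.sum_comm, ← Finset.sum_add_distrib]
    refine Finset.sum_congr rfl fun i _ => ?_
    rw [← Finset.sum_add_distrib]
    exact Finset.sum_congr rfl fun j _ => by ring
  have e2 : ∀ i, (∑ j, (bz (base.neg j i) + bz (base.neg i j)) * y i) =
      (∑ j, bz (negNegOne (base.cls i)) * bz (negNegOne (base.cls j)) * y i) + bz (negNegOne (base.cls i)) * y i := by
    intro i
    have hpt : ∀ j, (bz (base.neg j i) + bz (base.neg i j)) * y i =
        bz (negNegOne (base.cls i)) * bz (negNegOne (base.cls j)) * y i + (if j = i then bz (negNegOne (base.cls i)) * y i else 0) := by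
      intro j
      by_cases hji : j = i
      · subst hji
        rw [if_pos rfl]
        linear_combination (h2 (bz (base.neg j j))) * y j - (hsq (bz (negNegOne (base.cls j)))) * y j -
          h2 (bz (negNegOne (base.cls j)) * y j)
      · have hij : i ≠ j := fun h => hji h.symm
        rw [if_neg hji, base.bz_neg_swap hij, bz_and_mul]
        linear_combination (h2 (bz (base.neg i j))) * y i
    rw [Finset.sum_congr rfl fun j _ => hpt j, Finset.sum_add_distrib, Finset.sum_ite_eq' Finset.univ i]
    simp only [Finset.mem_univ, if_true]
  rw [e1, Finset.sum_congr rfl fun i _ => e2 i, Finset.sum_add_distrib, add_mul, one_mul, Finset.mul_sum]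
  have e3 : ∀ i, (∑ j, bz (negNegOne (base.cls i)) * bz (negNegOne (base.cls j)) * y i) =
      (∑ b, bz (negNegOne (base.cls b))) * (bz (negNegOne (base.cls i)) * y i) := by
    intro i
    rw [Finset.sum_mul]
    exact Finset.sum_congr rfl fun j _ => by ring
  rw [Finset.sum_congr rfl fun i _ => e3 i, add_comm]

/-- ★ For bases with all `P_b ≡ 1, 3 (mod 8)` (`[(2/P_b) = −1] = [P_b ≡ 3 (4)]`) and μ odd, `⟨m, v⟩ = 0` for every even kernel pair `(u, v)`. -/
theorem sum_negNegOne_mul_snd_eq_zero_of_negTwo_eq (hmd : ∀ b, negTwo (base.cls b) = negNegOne (base.cls b))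
    (hμ : (∑ b, bz (negNegOne (base.cls b))) = 1) {p : (Fin (k + 1) → ZMod 2) × (Fin (k + 1) → ZMod 2)}
    (hp : p ∈ base.evenVirtualKernel) : (∑ j, bz (negNegOne (base.cls j)) * p.2 j) = 0 := by
  have h2 : ∀ x : ZMod 2, x + x = 0 := by decide
  rw [mem_evenVirtualKernel_iff] at hp
  simp only [hmd] at hp
  have hs : (∑ i, ((∑ j, bz (base.neg i j) * (p.1 j + p.1 i)) +
      bz (negNegOne (base.cls i)) * (∑ j, bz (negNegOne (base.cls j)) * p.1 j) +
      bz (negNegOne (base.cls i)) * p.1 i + bz (negNegOne (base.cls i)) * p.2 i)) = 0 :=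
    Finset.sum_eq_zero fun i _ => hp.1 i
  rw [Finset.sum_add_distrib, Finset.sum_add_distrib, Finset.sum_add_distrib, sum_lap_eq', hμ, ← Finset.sum_mul, hμ] at hs
  linear_combination hs - 2 * h2 (∑ j, bz (negNegOne (base.cls j)) * p.1 j)

/-- ★ For such bases `(1, 0)` is an even kernel pair. -/
theorem one_zero_mem_evenVirtualKernel_of_negTwo_eq (hmd : ∀ b, negTwo (base.cls b) = negNegOne (base.cls b))
    (hμ : (∑ b, bz (negNegOne (base.cls b))) = 1) :
    ((fun _ => (1 : ZMod 2), (0 : Fin (k + 1) → ZMod 2)) : (Fin (k + 1) → ZMod 2) × (Fin (k + 1) → ZMod 2)) ∈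
      base.evenVirtualKernel := by
  have h2 : ∀ x : ZMod 2, x + x = 0 := by decide
  rw [mem_evenVirtualKernel_iff]
  constructor <;> intro i <;> simp [hmd, hμ, h2]

/-- ★★ **The order-three symmetry.** For such bases, `(u, v) ∈ 𝒦_ev ⇒ (u + v, u + ⟨m,u⟩·1) ∈ 𝒦_ev` (the map `(u;w) ↦ (w; u+w)` preserves the
alternating matrix `Ŝ + δδᵀ = [[L+Lᵀ, Lᵀ],[L, L+Lᵀ]]`). -/
theorem cycle_mem_evenVirtualKernel_of_negTwo_eq (hmd : ∀ b, negTwo (base.cls b) = negNegOne (base.cls b))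
    (hμ : (∑ b, bz (negNegOne (base.cls b))) = 1) {p : (Fin (k + 1) → ZMod 2) × (Fin (k + 1) → ZMod 2)}
    (hp : p ∈ base.evenVirtualKernel) :
    ((fun b => p.1 b + p.2 b, fun b => p.1 b + ∑ j, bz (negNegOne (base.cls j)) * p.1 j) :
      (Fin (k + 1) → ZMod 2) × (Fin (k + 1) → ZMod 2)) ∈ base.evenVirtualKernel := by
  have h2 : ∀ x : ZMod 2, x + x = 0 := by decide
  have hMv := sum_negNegOne_mul_snd_eq_zero_of_negTwo_eq base hmd hμ hp
  rw [mem_evenVirtualKernel_iff] at hp ⊢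
  simp only [hmd] at hp ⊢
  obtain ⟨hE1, hE2⟩ := hp
  set M : ZMod 2 := ∑ j, bz (negNegOne (base.cls j)) * p.1 j with hM
  have hMuv : (∑ j, bz (negNegOne (base.cls j)) * (p.1 j + p.2 j)) = M := by
    rw [hM, ← add_zero (∑ j, bz (negNegOne (base.cls j)) * p.1 j), ← hMv, ← Finset.sum_add_distrib]
    exact Finset.sum_congr rfl fun j _ => by ring
  have hMuc : (∑ j, bz (negNegOne (base.cls j)) * (p.1 j + M)) = M + M := by
    simp only [mul_add]
    rw [Finset.sum_add_distrib, ← Finset.sum_mul, hμ, one_mul]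
  have hsplit : ∀ i, (∑ j, bz (base.neg i j) * ((p.1 j + p.2 j) + (p.1 i + p.2 i))) =
      (∑ j, bz (base.neg i j) * (p.1 j + p.1 i)) + ∑ j, bz (base.neg i j) * (p.2 j + p.2 i) := by
    intro i
    rw [← Finset.sum_add_distrib]
    exact Finset.sum_congr rfl fun j _ => by ring
  have hsplit2 : ∀ i, (∑ j, bz (base.neg i j) * ((p.1 j + M) + (p.1 i + M))) = ∑ j, bz (base.neg i j) * (p.1 j + p.1 i) := by
    intro i
    exact Finset.sum_congr rfl fun j _ => by linear_combination (bz (base.neg i j)) * h2 M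
  refine ⟨fun i => ?_, fun i => ?_⟩
  · rw [hsplit, hMuv]
    have e1 := hE1 i
    have e2 := hE2 i
    linear_combination e1 + e2 - h2 (bz (negNegOne (base.cls i)) * p.2 i)
  · rw [hsplit2, hMuv]
    have e1 := hE1 i
    linear_combination e1 + h2 (bz (negNegOne (base.cls i)) * p.1 i) + h2 (bz (negNegOne (base.cls i)) * M)

/-- ★★ **The pencil of `δ = 1` is invariant under the order-three map `θ(p, q) = (q, p + q)`** (bases with all `P_b ≡ 1, 3 (mod 8)`, μ odd). -/
theorem theta_mem_evenPencil_one_of_negTwo_eq (hmd : ∀ b, negTwo (base.cls b) = negNegOne (base.cls b))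
    (hμ : (∑ b, bz (negNegOne (base.cls b))) = 1) {p : (Fin (k + 1) → ZMod 2) × (Fin (k + 1) → ZMod 2)}
    (hp : p ∈ base.evenPencil (fun _ => (1 : ZMod 2))) :
    ((p.2, p.1 + p.2) : (Fin (k + 1) → ZMod 2) × (Fin (k + 1) → ZMod 2)) ∈ base.evenPencil (fun _ => (1 : ZMod 2)) := by
  have h2 : ∀ x : ZMod 2, x + x = 0 := by decide
  have h11 : (1 : ZMod 2) + 1 = 0 := h2 1
  obtain ⟨u, v, γ, hE1, hE2, rfl⟩ := (mem_evenPencil_iff base _ p).1 hp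
  have hq : ((u, v) : (Fin (k + 1) → ZMod 2) × (Fin (k + 1) → ZMod 2)) ∈ base.evenVirtualKernel :=
    (mem_evenVirtualKernel_iff base (u, v)).2 ⟨hE1, hE2⟩
  have hq' := base.evenVirtualKernel.add_mem (cycle_mem_evenVirtualKernel_of_negTwo_eq base hmd hμ hq)
    (base.evenVirtualKernel.smul_mem γ (one_zero_mem_evenVirtualKernel_of_negTwo_eq base hmd hμ))
  set M : ZMod 2 := ∑ j, bz (negNegOne (base.cls j)) * u j with hM
  obtain ⟨hE1', hE2'⟩ := (mem_evenVirtualKernel_iff base _).1 hq'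
  refine (mem_evenPencil_iff base _ _).2 ⟨fun b => u b + v b + γ, fun b => u b + M, M, ?_, ?_, ?_⟩
  · intro b
    have e := hE1' b
    simp only [Prod.fst_add, Prod.snd_add, Prod.smul_fst, Prod.smul_snd, Pi.add_apply, Pi.smul_apply, smul_eq_mul, mul_one,
      Pi.zero_apply, mul_zero, add_zero] at e
    exact e
  · intro b
    have e := hE2' b
    simp only [Prod.fst_add, Prod.snd_add, Prod.smul_fst, Prod.smul_snd, Pi.add_apply, Pi.smul_apply, smul_eq_mul, mul_one,
      Pi.zero_apply, mul_zero, add_zero] at e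
    exact e
  · refine Prod.ext ?_ ?_
    · funext b
      simp only [h11, mul_zero, add_zero, mul_one]
      linear_combination -(h2 M)
    · funext b
      simp only [Pi.add_apply, h11, mul_zero, add_zero, mul_one]
      ring

/-- ★★★ **EVEN UNIVERSALITY ON THE FAMILY `P_b ≡ 1, 3 (mod 8)` — no exceptional class.** Let `n = 2·P₀⋯P_k` with every `P_b ≡ 1` or `3 (mod 8)`
(`[(2/P_b) = −1] = [P_b ≡ 3 (4)]` for all `b`) and an odd number of `P_b ≡ 3 (mod 8)` (root number `−1`). Then the design `δ = 1` satisfies all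
hypotheses of EVEN THEOREM A, so a pattern-free Heegner recipe with `τ₀^{ev} + 1` auxiliary primes exists, for EVERY base of the family and every `k`.
Proof: the pencil `W_ev(1)` is invariant under the order-three automorphism `θ(p,q) = (q, p+q)` of `V × V` (`theta_mem_evenPencil_one_of_negTwo_eq`
— in the coordinates `(u; u+v)` the radical `𝒦_ev ⊕ ⟨(0,1)⟩` is the kernel of the alternating matrix `[[L+Lᵀ, Lᵀ],[L, L+Lᵀ]] = N + Nᵀ`,
`N = L ⊗ (1 0; 1 1)`, preserved by `(u;w) ↦ (w;u+w)`), and `θ` cycles `V×0 → 0×V → Δ → V×0`; hence the three plane sections have the same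
dimension `e`, and `2e ≤ dim W_ev(1) = dim 𝒦_ev + 1` because `W ∩ (V×0)` and `W ∩ (0×V)` are independent. [cite: HeathBrown1994SelmerCongruentII,
Appendix (Monsky), typescript p. 41 L20–L36] -/
theorem exists_patternFree_even_design_of_negTwo_eq_negNegOne (hmd : ∀ b, negTwo (base.cls b) = negNegOne (base.cls b))
    (hμ : (∑ b, bz (negNegOne (base.cls b))) = 1) :
    ∃ (c₁ : AuxCell) (rest : List AuxCell), rest.length = (finrank (ZMod 2) ↥base.evenVirtualKernel + 1) / 2 ∧
      heegnerK base (c₁ :: rest) = true ∧ ∀ pat : ℕ → ℕ → Bool, (dataK base (c₁ :: rest) pat).monskyEvenS.det = 1 := by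
  have h2 : ∀ x : ZMod 2, x + x = 0 := by decide
  have h11 : (1 : ZMod 2) + 1 = 0 := h2 1
  set δ : Fin (k + 1) → ZMod 2 := fun _ => 1 with hδdef
  set W := base.evenPencil δ with hW
  -- legitimacy
  have hleg : ((δ, fun i => 1 + δ i) : (Fin (k + 1) → ZMod 2) × (Fin (k + 1) → ZMod 2)) ∉
      base.evenVirtualKernel.map (base.evenTwist δ) := by
    intro h
    obtain ⟨q, hq, hTq⟩ := Submodule.mem_map.1 h
    rw [evenTwist_apply] at hTq
    have hq1 : q.1 = 0 := by
      funext i; have := congrFun (congrArg Prod.snd hTq) i; simpa [hδdef, h11] using this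
    have hq2 : q.2 = fun _ => 1 := by
      funext i; have := congrFun (congrArg Prod.fst hTq) i; simpa [hδdef, h11, hq1] using this
    have hE1 := ((mem_evenVirtualKernel_iff base q).1 hq).1
    rw [hq1, hq2] at hE1
    have hm0 : ∀ i, bz (negNegOne (base.cls i)) = 0 := fun i => by
      have := hE1 i; simpa using this
    have : (∑ b, bz (negNegOne (base.cls b))) = 0 := Finset.sum_eq_zero fun b _ => hm0 b
    rw [hμ] at this
    exact one_ne_zero this
  have hdimW : finrank (ZMod 2) ↥W = finrank (ZMod 2) ↥base.evenVirtualKernel + 1 := finrank_evenPencil_eq base δ hleg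
  -- the three sections and the cycle `θ`
  set V2 := (Fin (k + 1) → ZMod 2) × (Fin (k + 1) → ZMod 2) with hV2
  set S1 := W ⊓ LinearMap.ker (LinearMap.snd (ZMod 2) (Fin (k + 1) → ZMod 2) (Fin (k + 1) → ZMod 2)) with hS1
  set S2 := W ⊓ LinearMap.ker (LinearMap.fst (ZMod 2) (Fin (k + 1) → ZMod 2) (Fin (k + 1) → ZMod 2)) with hS2
  set S3 := W ⊓ LinearMap.ker (LinearMap.fst (ZMod 2) (Fin (k + 1) → ZMod 2) (Fin (k + 1) → ZMod 2) +
      LinearMap.snd (ZMod 2) (Fin (k + 1) → ZMod 2) (Fin (k + 1) → ZMod 2)) with hS3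
  let θ : V2 →ₗ[ZMod 2] V2 :=
    (LinearMap.snd (ZMod 2) (Fin (k + 1) → ZMod 2) (Fin (k + 1) → ZMod 2)).prod
      (LinearMap.fst (ZMod 2) (Fin (k + 1) → ZMod 2) (Fin (k + 1) → ZMod 2) + LinearMap.snd (ZMod 2) (Fin (k + 1) → ZMod 2) (Fin (k + 1) → ZMod 2))
  have hθ : ∀ p : V2, θ p = (p.2, p.1 + p.2) := fun p => rfl
  have hθinj : Function.Injective θ := by
    intro p q hpq
    rw [hθ, hθ] at hpq
    have h2' : p.2 = q.2 := congrArg Prod.fst hpq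
    have h1' : p.1 + p.2 = q.1 + q.2 := congrArg Prod.snd hpq
    rw [h2'] at h1'
    exact Prod.ext (add_right_cancel h1') h2'
  have hθW : ∀ p ∈ W, θ p ∈ W := fun p hp => by
    rw [hθ]; exact theta_mem_evenPencil_one_of_negTwo_eq base hmd hμ hp
  have h12 : S1.map θ ≤ S2 := by
    intro x hx
    obtain ⟨p, hp, rfl⟩ := Submodule.mem_map.1 hx
    obtain ⟨hpW, hp0⟩ := Submodule.mem_inf.1 hp
    rw [LinearMap.mem_ker, LinearMap.snd_apply] at hp0
    refine Submodule.mem_inf.2 ⟨hθW p hpW, ?_⟩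
    rw [LinearMap.mem_ker, LinearMap.fst_apply, hθ]
    exact hp0
  have h23 : S2.map θ ≤ S3 := by
    intro x hx
    obtain ⟨p, hp, rfl⟩ := Submodule.mem_map.1 hx
    obtain ⟨hpW, hp0⟩ := Submodule.mem_inf.1 hp
    rw [LinearMap.mem_ker, LinearMap.fst_apply] at hp0
    refine Submodule.mem_inf.2 ⟨hθW p hpW, ?_⟩
    rw [LinearMap.mem_ker, LinearMap.add_apply, LinearMap.fst_apply, LinearMap.snd_apply, hθ]
    simp only [hp0, zero_add]
    funext i; exact h2 _
  have h31 : S3.map θ ≤ S1 := by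
    intro x hx
    obtain ⟨p, hp, rfl⟩ := Submodule.mem_map.1 hx
    obtain ⟨hpW, hp0⟩ := Submodule.mem_inf.1 hp
    rw [LinearMap.mem_ker, LinearMap.add_apply, LinearMap.fst_apply, LinearMap.snd_apply] at hp0
    refine Submodule.mem_inf.2 ⟨hθW p hpW, ?_⟩
    rw [LinearMap.mem_ker, LinearMap.snd_apply, hθ]
    exact hp0
  have f12 : finrank (ZMod 2) ↥S1 ≤ finrank (ZMod 2) ↥S2 :=
    (le_of_eq (LinearEquiv.finrank_eq (Submodule.equivMapOfInjective _ hθinj S1))).trans (Submodule.finrank_mono h12)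
  have f23 : finrank (ZMod 2) ↥S2 ≤ finrank (ZMod 2) ↥S3 :=
    (le_of_eq (LinearEquiv.finrank_eq (Submodule.equivMapOfInjective _ hθinj S2))).trans (Submodule.finrank_mono h23)
  have f31 : finrank (ZMod 2) ↥S3 ≤ finrank (ZMod 2) ↥S1 :=
    (le_of_eq (LinearEquiv.finrank_eq (Submodule.equivMapOfInjective _ hθinj S3))).trans (Submodule.finrank_mono h31)
  -- `S1 ⊕ S2 ≤ W`
  have hdis : S1 ⊓ S2 = ⊥ := by
    rw [Submodule.eq_bot_iff]
    intro p hp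
    obtain ⟨h1, h2'⟩ := Submodule.mem_inf.1 hp
    have a := (Submodule.mem_inf.1 h1).2
    have b := (Submodule.mem_inf.1 h2').2
    rw [LinearMap.mem_ker] at a b
    exact Prod.ext b a
  have hsum : finrank (ZMod 2) ↥S1 + finrank (ZMod 2) ↥S2 ≤ finrank (ZMod 2) ↥W := by
    have e := Submodule.finrank_sup_add_finrank_inf_eq S1 S2
    rw [hdis, finrank_bot, add_zero] at e
    rw [← e]
    exact Submodule.finrank_mono (sup_le inf_le_left inf_le_left)
  rw [hdimW] at hsum
  have b1 : finrank (ZMod 2) ↥S1 ≤ (finrank (ZMod 2) ↥base.evenVirtualKernel + 1) / 2 := by omega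
  have b2 : finrank (ZMod 2) ↥S2 ≤ (finrank (ZMod 2) ↥base.evenVirtualKernel + 1) / 2 := by omega
  have b3 : finrank (ZMod 2) ↥S3 ≤ (finrank (ZMod 2) ↥base.evenVirtualKernel + 1) / 2 := by omega
  exact exists_patternFree_even_design_pencil_of_odd base hμ δ hleg b1 b2 b3

end ClassesOneThree

end Summit.BirchSwinnertonDyer.BirchSwinnertonDyer.Theorems.SymbolicMonsky
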